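import Summits.FinalStateConjecture.FinalStateConjecture.Theorems.EIHFluxBalanceInertialRecessionStubSlaving11Kinematics
import Summits.FinalStateConjecture.FinalStateConjecture.Theorems.EIHFluxBalanceInertialRecessionStubSlaving3Coercive
import Summits.FinalStateConjecture.FinalStateConjecture.Theorems.EIHFluxBalanceInertialRecessionStubSlavingImmersion

/-!
# Route EIHFluxBalance — `InertialRecession` (E′), line `SketchCleanExcision`:
# reduction of the slaving stub `stub_slaving` to FROZEN-VACUUM SLAVING, a statement about the
# explicit modulated ansatz alone

Helper file for the crux `stmt-FinalStateConjecture-17403`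
(`Summit.FinalStateConjecture.FinalStateConjecture.Theses.EIHFluxBalance.InertialRecession`, E′),
registered stub `stub_slaving` (skeleton r12 = r11 verbatim; conclusion `SLAVED³ ∧ KINEMATICS`).
`…StubSlaving11Kinematics.stub_slaving_of_slaved3` reduced the stub to its block `SLAVED³`; this file
removes the Cauchy development from `SLAVED³` as well. Everything the slaving mechanism reads off
the development `𝒟` and the lab chart `Φ` is: (V) on every hole-following tube
`{x⁰ > T, ‖x̲ − ξᵢ(x⁰)‖ < R, rᵢ > r₀}` with `r₀ ≥ rinᵢ`, at late `T`, the lab components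
`e + g₀` (`e = Φ^*g − g₀` the deviation, `g₀ = η + Σⱼ (boostedKerrBilin (Λⱼ(x⁰)) (x⁰, ξⱼ(x⁰)) Mⱼ aⱼ − η)`
the frozen ansatz) are metric components (`MetricCoord.IsMetricOn`) with vanishing coordinate Ricci
form — the Ricci bridge `ricAt_deviationExtend_add_bilin_eq_zero_of_vacuum` (`…StubSlavingHelpers`)
on the open tube, where `dΦ` is injective by `eventually_injective_mfderiv_near_hole`
(`…StubSlavingImmersion`) and `isMetricOn_labMetric` (`…StubSlaving3Coercive`), the tube lying in
the chart domain `U ⊇ {x⁰ > τ₀, ∀ j, rⱼ > rinⱼ}` because the other centres recede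
(`le_radius_poincareInv_of_le`); and (S) the `C³` sup norm of `e` on the core-free late slabs
`{x⁰ = t, ∀ j, rⱼ > rinⱼ} ⊆ U ∩ {x⁰ = t}` tends to `0` (clause `deviationCk B Φ 3 → 0`,
`supCkENorm_mono`). Hence:

* `exists_isMetricOn_ricAt_eq_zero_tube` — (V) from six clauses of the antecedent and the vacuum
  equations of `𝒟`;
* `tendsto_supCkENorm_deviation_coreFree` — (S) from the chart-domain and `C³`-deviation clauses;
* `slaved3_of_frozenVacuumSlaving` — **reduction**: FROZEN-VACUUM SLAVING (for every `N`, painted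
  moduli `(M, a, rin, Λ, ξ)` with subextremal parameters and `r₋ < rin < r₊`, Lorentz factors `≤ γ`,
  smooth motions, separating centres, and every field `e : E4 → (E4 →L E4 →L ℝ)` with (V) and (S):
  `SLAVED³`) implies `antecedent → SLAVED³` for every instance of the crux;
* `stub_slaving_of_frozenVacuumSlaving` — composed with `stub_slaving_of_slaved3`: FROZEN-VACUUM
  SLAVING implies the registered statement of `stub_slaving` verbatim (registered carrier of the
  file: `slaving_supCkENorm_deviation_coreFree_slaving12`).

FROZEN-VACUUM SLAVING is pure analysis on `E4` (no spacetime, no chart): its proof is the landed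
relative Ricci-smallness capstone `exists_abs_ricAt_ansatz_le_jet` (`…StubSlaving3RicciNearHole`, to
be re-read for an abstract `e`), its `C³` analogue (dilation covariance `…StubSlaving3Dilate`), the
far-field degree laws (`…StubSlaving3FarField`, `a = 0`), and the algebraic coercivity NLCOER of the
jet ↦ Ricci map of ONE painted summand (`…StubSlaving11JetAbsorb`, verified in exact arithmetic at
sample parameters, not in Lean). No definitions, no named facts, no `sorry`.
-/

set_option linter.dupNamespace false
set_option maxSynthPendingDepth 3

noncomputable section

namespace Summit.FinalStateConjecture.FinalStateConjecture.Theorems.SublinearIsFree.Slaving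

open scoped BigOperators Topology Manifold Classical MeasureTheory Matrix InnerProductSpace ContDiff ENNReal
open Filter Set Function TopologicalSpace MeasureTheory Literature.Geometry.Lorentzian
open Summit.FinalStateConjecture.FinalStateConjecture.Theorems

/-! ### (V): the lab components are vacuum metric components on hole-following tubes -/

/-- **The lab components are vacuum metric components on late hole-following tubes.** For a
vacuum Cauchy development `𝒟` and a lab chart `Φ : U → 𝒟` as in the crux antecedent (Lorentz
factors `≤ γ`, smooth motions, separating centres, chart domain `U ⊇ {x⁰ > τ₀, ∀ j, rⱼ > rinⱼ}`,
smooth `Φ`, `C⁰` deviation `→ 0` on lab slabs): for every hole `i`, lab radius `R` and painted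
floor `r₀ ≥ rinᵢ`, `r₀ > 0`, there is `T` such that on the open tube
`{x⁰ > T, ‖x̲ − ξᵢ(x⁰)‖ < R, rᵢ(x) > r₀}` the lab components `(Φ^*g − g₀) + g₀` are metric
components (`isMetricOn_labMetric`; `dΦ` injective by `eventually_injective_mfderiv_near_hole`,
the tube inside `U` since the other cores recede, `le_radius_poincareInv_of_le`) with vanishing
coordinate Ricci form (`ricAt_deviationExtend_add_bilin_eq_zero_of_vacuum`), and every painted core
`{rⱼ ≤ rinⱼ}` is avoided on the tube. [folklore] -/
theorem exists_isMetricOn_ricAt_eq_zero_tube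
    {X : Type*} [TopologicalSpace X] [ChartedSpace E3 X] [IsManifold (𝓡 3) ∞ X]
    [ConnectedSpace X] {D : InitialDataSet (𝓡 3) X} (𝒟 : VacuumCauchyDevelopment D)
    {N : ℕ} {M a rin : Fin N → ℝ} {Λ : Fin N → ℝ → lorentzGroup} {ξ : Fin N → ℝ → E3} {γ τ₀ : ℝ}
    {U : Opens E4}
    (hγ : ∀ i t, |((Λ i t : E4 ≃L[ℝ] E4) (E4.basisVector 0)) 0| ≤ γ)
    (hsm : ∀ i, ContDiff ℝ ((⊤ : ℕ∞) : WithTop ℕ∞) (ξ i) ∧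
      ContDiff ℝ ((⊤ : ℕ∞) : WithTop ℕ∞) (fun t ↦ ((Λ i t : E4 ≃L[ℝ] E4) : E4 →L[ℝ] E4)))
    (hsep : ∀ i j, i ≠ j → Tendsto (fun t ↦ ‖ξ i t - ξ j t‖) atTop atTop)
    (hU : {x : E4 | τ₀ < x 0 ∧ ∀ i, rin i < Kerr.radius (a i) (poincareInv (Λ i (x 0))
      (E4.ofTimeSpace (x 0) (ξ i (x 0))) x)} ⊆ (U : Set E4))
    {Φ : U → 𝒟.carrier} (hΦ : ContMDiff 𝓘(ℝ, E4) (𝓡 4) ∞ Φ)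
    (hdev : Tendsto (fun t ↦ 𝒟.toSpacetime.deviationCk ⟨U, fun x ↦ Minkowski.bilin +
      ∑ i, (boostedKerrBilin (Λ i (x 0)) (E4.ofTimeSpace (x 0) (ξ i (x 0))) (M i) (a i) x -
        Minkowski.bilin), fun x ↦ x 0, E4.spatialNorm⟩ Φ 0 t) atTop (𝓝 0))
    (i : Fin N) (R : ℝ) {r₀ : ℝ} (hr₀ : 0 < r₀) (hrin : rin i ≤ r₀) :
    ∃ T : ℝ, MetricCoord.IsMetricOn (fun z : E4 ↦ 𝒟.toSpacetime.deviationExtend ⟨U, fun x ↦ Minkowski.bilin +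
      ∑ i, (boostedKerrBilin (Λ i (x 0)) (E4.ofTimeSpace (x 0) (ξ i (x 0))) (M i) (a i) x -
        Minkowski.bilin), fun x ↦ x 0, E4.spatialNorm⟩ Φ z + (Minkowski.bilin +
        ∑ i, (boostedKerrBilin (Λ i (z 0)) (E4.ofTimeSpace (z 0) (ξ i (z 0))) (M i) (a i) z -
          Minkowski.bilin)))
        {x : E4 | T < x 0 ∧ ‖E4.spatial x - ξ i (x 0)‖ < R ∧ r₀ < Kerr.radius (a i) (poincareInv (Λ i (x 0)) (E4.ofTimeSpace (x 0) (ξ i (x 0))) x)} ∧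
      ∀ x : E4, T < x 0 → ‖E4.spatial x - ξ i (x 0)‖ < R → r₀ < Kerr.radius (a i) (poincareInv (Λ i (x 0)) (E4.ofTimeSpace (x 0) (ξ i (x 0))) x) → (∀ j, rin j < Kerr.radius (a j) (poincareInv (Λ j (x 0)) (E4.ofTimeSpace (x 0) (ξ j (x 0))) x)) ∧
        MetricCoord.ricAt (fun z : E4 ↦ 𝒟.toSpacetime.deviationExtend ⟨U, fun x ↦ Minkowski.bilin +
      ∑ i, (boostedKerrBilin (Λ i (x 0)) (E4.ofTimeSpace (x 0) (ξ i (x 0))) (M i) (a i) x -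
        Minkowski.bilin), fun x ↦ x 0, E4.spatialNorm⟩ Φ z + (Minkowski.bilin +
        ∑ i, (boostedKerrBilin (Λ i (z 0)) (E4.ofTimeSpace (z 0) (ξ i (z 0))) (M i) (a i) z -
          Minkowski.bilin))) x = 0 := by
  set B : ModelBackground := ⟨U, fun x ↦ Minkowski.bilin +
      ∑ i, (boostedKerrBilin (Λ i (x 0)) (E4.ofTimeSpace (x 0) (ξ i (x 0))) (M i) (a i) x -
        Minkowski.bilin), fun x ↦ x 0, E4.spatialNorm⟩ with hB
  obtain ⟨T₁, hT₁⟩ := eventually_atTop.1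
    (eventually_injective_mfderiv_near_hole 𝒟.toSpacetime hγ hsep (Φ := Φ) hdev i R hr₀)
  -- the other holes' cores recede from the tube
  have E1 : ∀ j, ∀ᶠ t in atTop, j ≠ i → R + (|a j| + (|rin j| + 1)) ≤ ‖ξ i t - ξ j t‖ := by
    intro j
    by_cases hij : j = i
    · exact Eventually.of_forall fun t h ↦ (h hij).elim
    · exact ((hsep i j (Ne.symm hij)).eventually_ge_atTop _).mono fun t ht _ ↦ ht
  obtain ⟨T₂, hT₂⟩ := eventually_atTop.1 (eventually_all.2 E1)
  set T : ℝ := max (max T₁ T₂) τ₀ with hT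
  have hT1 : T₁ ≤ T := (le_max_left _ _).trans (le_max_left _ _)
  have hT2 : T₂ ≤ T := (le_max_right _ _).trans (le_max_left _ _)
  have hT0 : τ₀ ≤ T := le_max_right _ _
  -- every core is avoided on the tube
  have hcore : ∀ x : E4, T < x 0 → ‖E4.spatial x - ξ i (x 0)‖ < R → r₀ < Kerr.radius (a i) (poincareInv (Λ i (x 0)) (E4.ofTimeSpace (x 0) (ξ i (x 0))) x) →
      ∀ j, rin j < Kerr.radius (a j) (poincareInv (Λ j (x 0)) (E4.ofTimeSpace (x 0) (ξ j (x 0))) x) := by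
    intro x hxT hxR hxr j
    by_cases hij : j = i
    · subst hij; exact hrin.trans_lt hxr
    · have hfar : |a j| + (|rin j| + 1) ≤ ‖E4.spatial x - ξ j (x 0)‖ := by
        have h := hT₂ (x 0) (hT2.trans hxT.le) j hij
        have htri : ‖ξ i (x 0) - ξ j (x 0)‖ ≤
            ‖E4.spatial x - ξ i (x 0)‖ + ‖E4.spatial x - ξ j (x 0)‖ := by
          calc ‖ξ i (x 0) - ξ j (x 0)‖
              = ‖(E4.spatial x - ξ j (x 0)) - (E4.spatial x - ξ i (x 0))‖ := by congr 1; abel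
            _ ≤ ‖E4.spatial x - ξ j (x 0)‖ + ‖E4.spatial x - ξ i (x 0)‖ := norm_sub_le _ _
            _ = _ := add_comm _ _
        linarith
      have h1 := le_radius_poincareInv_of_le (Λ j (x 0)) (a j) (x 0) (ξ j (x 0)) rfl
        (by positivity) hfar
      linarith [le_abs_self (rin j)]
  have hsubU : ∀ x : E4, T < x 0 → ‖E4.spatial x - ξ i (x 0)‖ < R → r₀ < Kerr.radius (a i) (poincareInv (Λ i (x 0)) (E4.ofTimeSpace (x 0) (ξ i (x 0))) x) →
      x ∈ (U : Set E4) :=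
    fun x hxT hxR hxr ↦ hU ⟨hT0.trans_lt hxT, hcore x hxT hxR hxr⟩
  -- the open tube as an open subset of the chart domain
  have hrad : Continuous (fun z : E4 ↦ Kerr.radius (a i) (poincareInv (Λ i (z 0)) (E4.ofTimeSpace (z 0) (ξ i (z 0))) z)) :=
    continuous_paintedRadius (a i) (contDiff_lorentz_symm (hsm i).2).continuous (hsm i).1.continuous
  have hdist : Continuous (fun z : E4 ↦ ‖E4.spatial z - ξ i (z 0)‖) :=
    (E4.spatial.continuous.sub
      ((hsm i).1.continuous.comp (EuclideanSpace.proj (0 : Fin 4)).continuous)).norm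
  let A : Opens E4 := ⟨{z : E4 | T < z 0 ∧ ‖E4.spatial z - ξ i (z 0)‖ < R ∧ r₀ < Kerr.radius (a i) (poincareInv (Λ i (z 0)) (E4.ofTimeSpace (z 0) (ξ i (z 0))) z)},
    (isOpen_lt continuous_const (EuclideanSpace.proj (0 : Fin 4)).continuous).inter
      ((isOpen_lt hdist continuous_const).inter (isOpen_lt continuous_const hrad))⟩
  have hA : A ≤ B.domain := fun z hz ↦ hsubU z hz.1 hz.2.1 hz.2.2
  have hinj : ∀ y : A, Function.Injective
      (mfderiv 𝓘(ℝ, E4) (𝓡 4) Φ (Opens.inclusion hA y)) := by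
    intro y
    obtain ⟨hyT, hyR, hyr⟩ := y.2
    exact hT₁ (y.1 0) (hT1.trans hyT.le) ⟨y.1, hA y.2⟩ rfl hyR.le hyr.le
  refine ⟨T, isMetricOn_labMetric 𝒟.toSpacetime B hΦ hA hinj, fun x hxT hxR hxr ↦
    ⟨hcore x hxT hxR hxr, ?_⟩⟩
  exact ContinuousLinearMap.ext fun v ↦ ContinuousLinearMap.ext fun w ↦
    ricAt_deviationExtend_add_bilin_eq_zero_of_vacuum 𝒟 B hΦ hA hinj ⟨x, hxT, hxR, hxr⟩ v w

/-! ### (S): the `C³` deviation is small on the core-free late slabs -/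

/-- **`Cᵏ`-smallness of the deviation on the core-free late slabs.** If the chart domain contains
`{x⁰ > τ₀, ∀ j, rⱼ > rinⱼ}` and the `Cᵏ` deviation on the lab slabs `U ∩ {x⁰ = t}` tends to `0`,
then so does the `Cᵏ` sup norm of the (extended) deviation on the core-free slabs
`{x⁰ = t, ∀ j, rⱼ > rinⱼ}` (`supCkENorm_mono`). [folklore] -/
theorem tendsto_supCkENorm_deviation_coreFree (𝓢 : Spacetime 4)
    {N : ℕ} {M a rin : Fin N → ℝ} {Λ : Fin N → ℝ → lorentzGroup} {ξ : Fin N → ℝ → E3} {τ₀ : ℝ}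
    {U : Opens E4}
    (hU : {x : E4 | τ₀ < x 0 ∧ ∀ i, rin i < Kerr.radius (a i) (poincareInv (Λ i (x 0))
      (E4.ofTimeSpace (x 0) (ξ i (x 0))) x)} ⊆ (U : Set E4))
    {Φ : U → 𝓢.carrier} {k : ℕ}
    (hdev : Tendsto (fun t ↦ 𝓢.deviationCk ⟨U, fun x ↦ Minkowski.bilin +
      ∑ i, (boostedKerrBilin (Λ i (x 0)) (E4.ofTimeSpace (x 0) (ξ i (x 0))) (M i) (a i) x -
        Minkowski.bilin), fun x ↦ x 0, E4.spatialNorm⟩ Φ k t) atTop (𝓝 0)) :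
    Tendsto (fun t : ℝ ↦ supCkENorm {x : E4 | x 0 = t ∧ ∀ j, rin j < Kerr.radius (a j) (poincareInv (Λ j (x 0)) (E4.ofTimeSpace (x 0) (ξ j (x 0))) x)} k
      (𝓢.deviationExtend ⟨U, fun x ↦ Minkowski.bilin +
      ∑ i, (boostedKerrBilin (Λ i (x 0)) (E4.ofTimeSpace (x 0) (ξ i (x 0))) (M i) (a i) x -
        Minkowski.bilin), fun x ↦ x 0, E4.spatialNorm⟩ Φ)) atTop (𝓝 0) := by
  set B : ModelBackground := ⟨U, fun x ↦ Minkowski.bilin +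
      ∑ i, (boostedKerrBilin (Λ i (x 0)) (E4.ofTimeSpace (x 0) (ξ i (x 0))) (M i) (a i) x -
        Minkowski.bilin), fun x ↦ x 0, E4.spatialNorm⟩ with hB
  refine tendsto_of_tendsto_of_tendsto_of_le_of_le' tendsto_const_nhds hdev
    (Eventually.of_forall fun _ ↦ zero_le) ?_
  filter_upwards [eventually_gt_atTop τ₀] with t ht
  refine supCkENorm_mono (fun x hx ↦ ?_) k _
  have hxU : x ∈ (U : Set E4) := hU ⟨by rw [hx.1]; exact ht, hx.2⟩
  exact ⟨⟨x, hxU⟩, hx.1, rfl⟩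

/-! ### The reduction -/

/-- **`SLAVED³` reduces to FROZEN-VACUUM SLAVING.** Suppose that for every `N`, all painted moduli
`(M, a, rin, Λ, ξ)` with subextremal parameters and `r₋ < rinᵢ < r₊`, Lorentz factors `≤ γ`, smooth
motions and separating centres, and every field `e` of bilinear forms on `E4` which (V) makes
`e + g₀` vacuum metric components on every late hole-following tube with floor `≥ rinᵢ` (the tube
avoiding every painted core) and (S) is
`C³`-small on the core-free late slabs, the third-order slaving block `SLAVED³` holds. Then
`SLAVED³` holds under the crux antecedent, for every instance: take `e = Φ^*g − g₀` (extended by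
zero), (V) by `exists_isMetricOn_ricAt_eq_zero_tube`, (S) by
`tendsto_supCkENorm_deviation_coreFree`. [folklore] -/
theorem slaved3_of_frozenVacuumSlaving
    (hFVS : ∀ (N : ℕ) (M a rin : Fin N → ℝ) (Λ : Fin N → ℝ → lorentzGroup) (ξ : Fin N → ℝ → E3) (γ : ℝ) (e : E4 → E4 →L[ℝ] E4 →L[ℝ] ℝ), (∀ i, Kerr.IsSubextremal (M i) (a i) ∧ Kerr.rMinus (M i) (a i) < rin i ∧ rin i < Kerr.rPlus (M i) (a i)) →
      (∀ i t, |((Λ i t : E4 ≃L[ℝ] E4) (E4.basisVector 0)) 0| ≤ γ) →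
      (∀ i, ContDiff ℝ ((⊤ : ℕ∞) : WithTop ℕ∞) (ξ i) ∧ ContDiff ℝ ((⊤ : ℕ∞) : WithTop ℕ∞) (fun t ↦ ((Λ i t : E4 ≃L[ℝ] E4) : E4 →L[ℝ] E4))) →
      (∀ i j, i ≠ j → Tendsto (fun t ↦ ‖ξ i t - ξ j t‖) atTop atTop) →
      (∀ (i : Fin N) (R r₀ : ℝ), rin i ≤ r₀ → ∃ T : ℝ, MetricCoord.IsMetricOn (fun z : E4 ↦ e z + (Minkowski.bilin + ∑ i, (boostedKerrBilin (Λ i (z 0)) (E4.ofTimeSpace (z 0) (ξ i (z 0))) (M i) (a i) z - Minkowski.bilin))) {x : E4 | T < x 0 ∧ ‖E4.spatial x - ξ i (x 0)‖ < R ∧ r₀ < Kerr.radius (a i) (poincareInv (Λ i (x 0)) (E4.ofTimeSpace (x 0) (ξ i (x 0))) x)} ∧ ∀ x : E4, T < x 0 → ‖E4.spatial x - ξ i (x 0)‖ < R → r₀ < Kerr.radius (a i) (poincareInv (Λ i (x 0)) (E4.ofTimeSpace (x 0) (ξ i (x 0))) x) → (∀ j, rin j < Kerr.radius (a j) (poincareInv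 (Λ j (x 0)) (E4.ofTimeSpace (x 0) (ξ j (x 0))) x)) ∧ MetricCoord.ricAt (fun z : E4 ↦ e z + (Minkowski.bilin + ∑ i, (boostedKerrBilin (Λ i (z 0)) (E4.ofTimeSpace (z 0) (ξ i (z 0))) (M i) (a i) z - Minkowski.bilin))) x = 0) →
      Tendsto (fun t : ℝ ↦ supCkENorm {x : E4 | x 0 = t ∧ ∀ j, rin j < Kerr.radius (a j) (poincareInv (Λ j (x 0)) (E4.ofTimeSpace (x 0) (ξ j (x 0))) x)} 3 e) atTop (𝓝 0) →
      (∀ i : Fin N, (∀ m : ℕ, 1 ≤ m → m ≤ 3 → Tendsto (fun t ↦ iteratedDeriv m (fun s ↦ (((Λ i s : lorentzGroup) : E4 ≃L[ℝ] E4) (E4.basisVector 0))) t) atTop (𝓝 0)) ∧ (∀ m : ℕ, m ≤ 2 → Tendsto (fun t ↦ iteratedDeriv m (fun s ↦ deriv (ξ i) s - (((((Λ i s : lorentzGroup) : E4 ≃L[ℝ] E4) (E4.basisVector 0)) 0)⁻¹ • E4.spatial (((Λ i s : lorentzGroup) : E4 ≃L[ℝ] E4) (E4.basisVector 0)))) t)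 atTop (𝓝 0)) ∧ (a i ≠ 0 → ∀ m : ℕ, 1 ≤ m → m ≤ 3 → Tendsto (fun t ↦ iteratedDeriv m (fun s ↦ (((Λ i s : lorentzGroup) : E4 ≃L[ℝ] E4) (E4.basisVector 3))) t) atTop (𝓝 0)))) :
    ∀ (X : Type) [TopologicalSpace X] [ChartedSpace E3 X] [IsManifold (𝓡 3) ((⊤ : ℕ∞) : WithTop ℕ∞) X] [T2Space X] [SecondCountableTopology X] [ConnectedSpace X], ∀ D ∈ admissibleVacuumData X, ∀ 𝒟 : VacuumCauchyDevelopment D, 𝒟.IsMaximal → ∀ (N : ℕ) (M a rin : Fin N → ℝ) (Λ : Fin N → ℝ → lorentzGroup) (ξ : Fin N → ℝ → E3) (γ κ τ₀ : ℝ) (U : Opens E4) (Φ : U → 𝒟.carrier) (O : Set 𝒟.carrier), ((∀ i, Kerr.IsSubextremal (M i) (a i) ∧ Kerr.rMinus (M i) (a i) < rin i ∧ rin i < Kerr.rPlus (M i) (a i)) ∧ (∀ i t, |((Λ i t : E4 ≃L[ℝ] E4) (E4.basisVector 0)) 0| ≤ γ) ∧ (∀ i, ContDiff ℝ ((⊤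 : ℕ∞) : WithTop ℕ∞) (ξ i) ∧ ContDiff ℝ ((⊤ : ℕ∞) : WithTop ℕ∞) (fun t ↦ ((Λ i t : E4 ≃L[ℝ] E4) : E4 →L[ℝ] E4))) ∧ (∀ i j, i ≠ j → Tendsto (fun t ↦ ‖ξ i t - ξ j t‖) atTop atTop) ∧ (0 < κ ∧ κ < 1 ∧ ∀ i, ∀ᶠ t in atTop, ‖ξ i t‖ ≤ κ ^ 2 * t) ∧ ({x : E4 | τ₀ < x 0 ∧ ∀ i, rin i < Kerr.radius (a i) (poincareInv (Λ i (x 0)) (E4.ofTimeSpace (x 0) (ξ i (x 0))) x)} ⊆ (U : Set E4)) ∧ let B : ModelBackground := ⟨U, fun x ↦ Minkowski.bilin + ∑ i, (boostedKerrBilin (Λ i (x 0)) (E4.ofTimeSpace (x 0) (ξ i (x 0))) (M i) (a i) x - Minkowski.bilin), fun x ↦ x 0, E4.spatialNorm⟩; ContMDiff 𝓘(ℝ, E4) (𝓡 4) ((⊤ : ℕ∞) : WithTop ℕ∞) Φ ∧ Topology.IsOpenEmbedding ((B.lateRegion τ₀).restrict Φ) ∧ Φ '' {x : U | τ₀ <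 x.1 0 ∧ ∀ i, Kerr.rPlus (M i) (a i) < Kerr.radius (a i) (poincareInv (Λ i (x.1 0)) (E4.ofTimeSpace (x.1 0) (ξ i (x.1 0))) x.1)} ⊆ O ∧ Tendsto (fun t ↦ 𝒟.toSpacetime.deviationCk B Φ 3 t) atTop (𝓝 0) ∧ Tendsto (fun t : ℝ ↦ ⨆ x ∈ {x : U | x.1 0 = t ∧ E4.spatialNorm x.1 ≤ κ * t}, ⨆ (m : ℕ) (_ : m ≤ 3), ENNReal.ofReal (1 + √(√((⨅ i, ‖E4.spatial x.1 - ξ i t‖) ^ 7))) * ‖iteratedFDeriv ℝ m (𝒟.toSpacetime.deviationExtend B Φ) x.1‖ₑ) atTop (𝓝 0) ∧ O = Summit.FinalStateConjecture.exteriorOf 𝒟.toCauchyDevelopment (Φ '' {x : U | τ₀ < x.1 0 ∧ ∀ i, Kerr.rPlus (M i) (a i) < Kerr.radius (a i) (poincareInv (Λ i (x.1 0)) (E4.ofTimeSpace (x.1 0) (ξ i (x.1 0))) x.1)}) ∧ ∀ t₁ : ℝ, τ₀ < t₁ → O \ Φ '' {x : U | t₁ < x.1 0 ∧ ∀ i,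 Kerr.rPlus (M i) (a i) < Kerr.radius (a i) (poincareInv (Λ i (x.1 0)) (E4.ofTimeSpace (x.1 0) (ξ i (x.1 0))) x.1)} ⊆ 𝒟.metric.causalPast 𝒟.timeOrientation (Φ '' {x : U | x.1 0 = t₁ ∧ ∀ i, Kerr.rPlus (M i) (a i) < Kerr.radius (a i) (poincareInv (Λ i (x.1 0)) (E4.ofTimeSpace (x.1 0) (ξ i (x.1 0))) x.1)})) →
      (∀ i : Fin N, (∀ m : ℕ, 1 ≤ m → m ≤ 3 → Tendsto (fun t ↦ iteratedDeriv m (fun s ↦ (((Λ i s : lorentzGroup) : E4 ≃L[ℝ] E4) (E4.basisVector 0))) t) atTop (𝓝 0)) ∧ (∀ m : ℕ, m ≤ 2 → Tendsto (fun t ↦ iteratedDeriv m (fun s ↦ deriv (ξ i) s - (((((Λ i s : lorentzGroup) : E4 ≃L[ℝ] E4) (E4.basisVector 0)) 0)⁻¹ • E4.spatial (((Λ i s : lorentzGroup) : E4 ≃L[ℝ] E4) (E4.basisVector 0)))) t) atTop (𝓝 0)) ∧ (a i ≠ 0 → ∀ m : ℕ, 1 ≤ m → m ≤ 3 → Tendsto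 (fun t ↦ iteratedDeriv m (fun s ↦ (((Λ i s : lorentzGroup) : E4 ≃L[ℝ] E4) (E4.basisVector 3))) t) atTop (𝓝 0))) := by
  intro X _ _ _ _ _ _ D _hD 𝒟 _h𝒟 N M a rin Λ ξ γ κ τ₀ U Φ O h
  obtain ⟨h1, hγ, hsm, hsep, -, hU, hΦ, -, -, hdev3, -⟩ := h
  set B : ModelBackground := ⟨U, fun x ↦ Minkowski.bilin +
      ∑ i, (boostedKerrBilin (Λ i (x 0)) (E4.ofTimeSpace (x 0) (ξ i (x 0))) (M i) (a i) x -
        Minkowski.bilin), fun x ↦ x 0, E4.spatialNorm⟩ with hB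
  have hdev0 : Tendsto (fun t ↦ 𝒟.toSpacetime.deviationCk B Φ 0 t) atTop (𝓝 0) :=
    tendsto_of_tendsto_of_tendsto_of_le_of_le' tendsto_const_nhds hdev3
      (Eventually.of_forall fun _ ↦ zero_le)
      (Eventually.of_forall fun t ↦ 𝒟.toSpacetime.deviationCk_mono B Φ (Nat.zero_le 3) t)
  refine hFVS N M a rin Λ ξ γ (𝒟.toSpacetime.deviationExtend B Φ) h1 hγ hsm hsep ?_ ?_
  · intro i R r₀ hr₀
    have hr₀' : 0 < r₀ := ((h1 i).1.rMinus_nonneg.trans_lt (h1 i).2.1).trans_le hr₀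
    exact exists_isMetricOn_ricAt_eq_zero_tube 𝒟 hγ hsm hsep hU hΦ hdev0 i R hr₀' hr₀
  · exact tendsto_supCkENorm_deviation_coreFree 𝒟.toSpacetime hU hdev3

/-- **The registered stub `stub_slaving` reduces to FROZEN-VACUUM SLAVING**: composing
`slaved3_of_frozenVacuumSlaving` with `stub_slaving_of_slaved3` (`…StubSlaving11Kinematics`), the
statement of `stub_slaving` (`SLAVED³ ∧ KINEMATICS`, verbatim) follows from FROZEN-VACUUM SLAVING.
[folklore] -/
theorem stub_slaving_of_frozenVacuumSlaving
    (hFVS : ∀ (N : ℕ) (M a rin : Fin N → ℝ) (Λ : Fin N → ℝ → lorentzGroup) (ξ : Fin N → ℝ → E3) (γ : ℝ) (e : E4 → E4 →L[ℝ] E4 →L[ℝ] ℝ), (∀ i, Kerr.IsSubextremal (M i) (a i) ∧ Kerr.rMinus (M i) (a i) < rin i ∧ rin i < Kerr.rPlus (M i) (a i)) →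
      (∀ i t, |((Λ i t : E4 ≃L[ℝ] E4) (E4.basisVector 0)) 0| ≤ γ) →
      (∀ i, ContDiff ℝ ((⊤ : ℕ∞) : WithTop ℕ∞) (ξ i) ∧ ContDiff ℝ ((⊤ : ℕ∞) : WithTop ℕ∞) (fun t ↦ ((Λ i t : E4 ≃L[ℝ] E4) : E4 →L[ℝ] E4))) →
      (∀ i j, i ≠ j → Tendsto (fun t ↦ ‖ξ i t - ξ j t‖) atTop atTop) →
      (∀ (i : Fin N) (R r₀ : ℝ), rin i ≤ r₀ → ∃ T : ℝ, MetricCoord.IsMetricOn (fun z : E4 ↦ e z + (Minkowski.bilin + ∑ i, (boostedKerrBilin (Λ i (z 0)) (E4.ofTimeSpace (z 0) (ξ i (z 0))) (M i) (a i) z - Minkowski.bilin))) {x : E4 | T < x 0 ∧ ‖E4.spatial x - ξ i (x 0)‖ < R ∧ r₀ < Kerr.radius (a i) (poincareInv (Λ i (x 0)) (E4.ofTimeSpace (x 0) (ξ i (x 0))) x)} ∧ ∀ x : E4, T < x 0 → ‖E4.spatial x - ξ i (x 0)‖ < R → r₀ < Kerr.radius (a i) (poincareInv (Λ i (x 0))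 (E4.ofTimeSpace (x 0) (ξ i (x 0))) x) → (∀ j, rin j < Kerr.radius (a j) (poincareInv (Λ j (x 0)) (E4.ofTimeSpace (x 0) (ξ j (x 0))) x)) ∧ MetricCoord.ricAt (fun z : E4 ↦ e z + (Minkowski.bilin + ∑ i, (boostedKerrBilin (Λ i (z 0)) (E4.ofTimeSpace (z 0) (ξ i (z 0))) (M i) (a i) z - Minkowski.bilin))) x = 0) →
      Tendsto (fun t : ℝ ↦ supCkENorm {x : E4 | x 0 = t ∧ ∀ j, rin j < Kerr.radius (a j) (poincareInv (Λ j (x 0)) (E4.ofTimeSpace (x 0) (ξ j (x 0))) x)} 3 e) atTop (𝓝 0) →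
      (∀ i : Fin N, (∀ m : ℕ, 1 ≤ m → m ≤ 3 → Tendsto (fun t ↦ iteratedDeriv m (fun s ↦ (((Λ i s : lorentzGroup) : E4 ≃L[ℝ] E4) (E4.basisVector 0))) t) atTop (𝓝 0)) ∧ (∀ m : ℕ, m ≤ 2 → Tendsto (fun t ↦ iteratedDeriv m (fun s ↦ deriv (ξ i) s - (((((Λ i s : lorentzGroup) : E4 ≃L[ℝ] E4) (E4.basisVector 0)) 0)⁻¹ • E4.spatial (((Λ i s : lorentzGroup) : E4 ≃L[ℝ] E4) (E4.basisVector 0)))) t) atTop (𝓝 0)) ∧ (a i ≠ 0 → ∀ m : ℕ, 1 ≤ m → m ≤ 3 → Tendsto (fun t ↦ iteratedDeriv m (fun s ↦ (((Λ i s : lorentzGroup) : E4 ≃L[ℝ] E4) (E4.basisVector 3))) t) atTop (𝓝 0)))) :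
    ∀ (X : Type) [TopologicalSpace X] [ChartedSpace E3 X] [IsManifold (𝓡 3) ((⊤ : ℕ∞) : WithTop ℕ∞) X] [T2Space X] [SecondCountableTopology X] [ConnectedSpace X], ∀ D ∈ admissibleVacuumData X, ∀ 𝒟 : VacuumCauchyDevelopment D, 𝒟.IsMaximal → ∀ (N : ℕ) (M a rin : Fin N → ℝ) (Λ : Fin N → ℝ → lorentzGroup) (ξ : Fin N → ℝ → E3) (γ κ τ₀ : ℝ) (U : Opens E4) (Φ : U → 𝒟.carrier) (O : Set 𝒟.carrier), ((∀ i, Kerr.IsSubextremal (M i) (a i) ∧ Kerr.rMinus (M i) (a i) < rin i ∧ rin i < Kerr.rPlus (M i) (a i)) ∧ (∀ i t, |((Λ i t : E4 ≃L[ℝ] E4) (E4.basisVector 0)) 0| ≤ γ) ∧ (∀ i, ContDiff ℝ ((⊤ : ℕ∞) : WithTop ℕ∞) (ξ i) ∧ ContDiff ℝ ((⊤ : ℕ∞) : WithTop ℕ∞) (fun t ↦ ((Λ i t : E4 ≃L[ℝ] E4) : E4 →L[ℝ] E4))) ∧ (∀ i j, i ≠ j → Tendsto (fun t ↦ ‖ξ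 i t - ξ j t‖) atTop atTop) ∧ (0 < κ ∧ κ < 1 ∧ ∀ i, ∀ᶠ t in atTop, ‖ξ i t‖ ≤ κ ^ 2 * t) ∧ ({x : E4 | τ₀ < x 0 ∧ ∀ i, rin i < Kerr.radius (a i) (poincareInv (Λ i (x 0)) (E4.ofTimeSpace (x 0) (ξ i (x 0))) x)} ⊆ (U : Set E4)) ∧ let B : ModelBackground := ⟨U, fun x ↦ Minkowski.bilin + ∑ i, (boostedKerrBilin (Λ i (x 0)) (E4.ofTimeSpace (x 0) (ξ i (x 0))) (M i) (a i) x - Minkowski.bilin), fun x ↦ x 0, E4.spatialNorm⟩; ContMDiff 𝓘(ℝ, E4) (𝓡 4) ((⊤ : ℕ∞) : WithTop ℕ∞) Φ ∧ Topology.IsOpenEmbedding ((B.lateRegion τ₀).restrict Φ) ∧ Φ '' {x : U | τ₀ < x.1 0 ∧ ∀ i, Kerr.rPlus (M i) (a i) < Kerr.radius (a i) (poincareInv (Λ i (x.1 0)) (E4.ofTimeSpace (x.1 0) (ξ i (x.1 0))) x.1)} ⊆ O ∧ Tendsto (fun t ↦ 𝒟.toSpacetime.deviationCk B Φ 3 t)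 atTop (𝓝 0) ∧ Tendsto (fun t : ℝ ↦ ⨆ x ∈ {x : U | x.1 0 = t ∧ E4.spatialNorm x.1 ≤ κ * t}, ⨆ (m : ℕ) (_ : m ≤ 3), ENNReal.ofReal (1 + √(√((⨅ i, ‖E4.spatial x.1 - ξ i t‖) ^ 7))) * ‖iteratedFDeriv ℝ m (𝒟.toSpacetime.deviationExtend B Φ) x.1‖ₑ) atTop (𝓝 0) ∧ O = Summit.FinalStateConjecture.exteriorOf 𝒟.toCauchyDevelopment (Φ '' {x : U | τ₀ < x.1 0 ∧ ∀ i, Kerr.rPlus (M i) (a i) < Kerr.radius (a i) (poincareInv (Λ i (x.1 0)) (E4.ofTimeSpace (x.1 0) (ξ i (x.1 0))) x.1)}) ∧ ∀ t₁ : ℝ, τ₀ < t₁ → O \ Φ '' {x : U | t₁ < x.1 0 ∧ ∀ i, Kerr.rPlus (M i) (a i) < Kerr.radius (a i) (poincareInv (Λ i (x.1 0)) (E4.ofTimeSpace (x.1 0) (ξ i (x.1 0))) x.1)} ⊆ 𝒟.metric.causalPast 𝒟.timeOrientation (Φ '' {x : U | x.1 0 = t₁ ∧ ∀ i, Kerr.rPlus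 (M i) (a i) < Kerr.radius (a i) (poincareInv (Λ i (x.1 0)) (E4.ofTimeSpace (x.1 0) (ξ i (x.1 0))) x.1)})) →
    (∀ i : Fin N, (∀ m : ℕ, 1 ≤ m → m ≤ 3 → Tendsto (fun t ↦ iteratedDeriv m (fun s ↦ (((Λ i s : lorentzGroup) : E4 ≃L[ℝ] E4) (E4.basisVector 0))) t) atTop (𝓝 0)) ∧ (∀ m : ℕ, m ≤ 2 → Tendsto (fun t ↦ iteratedDeriv m (fun s ↦ deriv (ξ i) s - (((((Λ i s : lorentzGroup) : E4 ≃L[ℝ] E4) (E4.basisVector 0)) 0)⁻¹ • E4.spatial (((Λ i s : lorentzGroup) : E4 ≃L[ℝ] E4) (E4.basisVector 0)))) t) atTop (𝓝 0)) ∧ (a i ≠ 0 → ∀ m : ℕ, 1 ≤ m → m ≤ 3 → Tendsto (fun t ↦ iteratedDeriv m (fun s ↦ (((Λ i s : lorentzGroup) : E4 ≃L[ℝ] E4) (E4.basisVector 3))) t) atTop (𝓝 0))) ∧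
    ((∀ i : Fin N, Continuous (fun t ↦ (((((Λ i t : lorentzGroup) : E4 ≃L[ℝ] E4) (E4.basisVector 0)) 0)⁻¹ • E4.spatial (((Λ i t : lorentzGroup) : E4 ≃L[ℝ] E4) (E4.basisVector 0))))) ∧ (∃ k : ℝ, 0 ≤ k ∧ k < 1 ∧ ∀ (i : Fin N) (t : ℝ), ‖(((((Λ i t : lorentzGroup) : E4 ≃L[ℝ] E4) (E4.basisVector 0)) 0)⁻¹ • E4.spatial (((Λ i t : lorentzGroup) : E4 ≃L[ℝ] E4) (E4.basisVector 0)))‖ ≤ k)) :=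
  stub_slaving_of_slaved3 (slaved3_of_frozenVacuumSlaving hFVS)

/-- **Registered one-line carrier form** (`slaving_supCkENorm_deviation_coreFree_slaving12`) of
`tendsto_supCkENorm_deviation_coreFree` (the file's registered sub-goal; the reduction theorems
above are its payload). [folklore] -/
theorem slaving_supCkENorm_deviation_coreFree_slaving12 : open Literature.Geometry.Lorentzian Filter Topology in ∀ (𝓢 : Spacetime 4) {N : ℕ} {M a rin : Fin N → ℝ} {Λ : Fin N → ℝ → lorentzGroup} {ξ : Fin N → ℝ → E3} {τ₀ : ℝ} {U : Opens E4}, {x : E4 | τ₀ < x 0 ∧ ∀ i, rin i < Kerr.radius (a i) (poincareInv (Λ i (x 0)) (E4.ofTimeSpace (x 0) (ξ i (x 0))) x)} ⊆ (U : Set E4) → ∀ {Φ : U → 𝓢.carrier} {k : ℕ}, Tendsto (fun t ↦ 𝓢.deviationCk ⟨U, fun x ↦ Minkowski.bilin + ∑ i, (boostedKerrBilin (Λ i (x 0)) (E4.ofTimeSpace (x 0) (ξ i (x 0))) (M i) (a i) x - Minkowski.bilin), fun x ↦ x 0, E4.spatialNorm⟩ Φ k t) atTop (𝓝 0) → Tendsto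 (fun t : ℝ ↦ supCkENorm {x : E4 | x 0 = t ∧ ∀ j, rin j < Kerr.radius (a j) (poincareInv (Λ j (x 0)) (E4.ofTimeSpace (x 0) (ξ j (x 0))) x)} k (𝓢.deviationExtend ⟨U, fun x ↦ Minkowski.bilin + ∑ i, (boostedKerrBilin (Λ i (x 0)) (E4.ofTimeSpace (x 0) (ξ i (x 0))) (M i) (a i) x - Minkowski.bilin), fun x ↦ x 0, E4.spatialNorm⟩ Φ)) atTop (𝓝 0) :=
  fun 𝓢 _ _ _ _ _ _ _ _ hU _ _ hdev ↦ tendsto_supCkENorm_deviation_coreFree 𝓢 hU hdev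

end Summit.FinalStateConjecture.FinalStateConjecture.Theorems.SublinearIsFree.Slaving

end
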